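import Literature.AlgebraicGeometry.Motives.CechPseudoCoherentAt
import Literature.AlgebraicGeometry.Motives.SeesawGrauertAffineCech
import HarnessLib

/-!
# Grauert's theorem in degree `0` for `𝒪(D)` and the seesaw theorem, one proper scheme at a time
# (Görtz–Wedhorn II, Cor. 23.135/23.137, Thm. 23.140 (3), Thm. 24.66 for a FIXED `X → Spec K`)

Second file of the re-threading, one proper scheme at a time, of the cohomological chain behind the
Theorem of the Cube (see `Motives/CechPseudoCoherentAt` for the rationale: for a projective `X` the
hypothesis `CechPseudoCoherentAt X` is Serre's finiteness theorem and Chow's lemma is not needed).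
Here: the representability half of the seesaw theorem. For a proper geometrically integral
`X → Spec K` with `CechPseudoCoherentAt X` (the Čech complexes of all `𝒪(D)` on all `X ×_K T` over
affine opens of `T` are pseudo-coherent) this file proves, with the proofs of the global chain
(`Motives/SeesawGrauertAffineCech`, `…Localization`, `…Gluing`, `Motives/SeesawGrauert`,
`Motives/SeesawCohomologyBaseChange`) specialised to `X`:

* `CechPseudoCoherentAt.sectionsOver_affine` — the affine form of the Grothendieck complex in
  degree `0` (Görtz–Wedhorn II, Cor. 23.137 at `B = A` and `B = κ(t)` with (23.28.5)–(23.28.6); the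
  statement of `grothendieckComplex_sectionsOver_affine` at `X`; proof of
  `grothendieckComplex_sectionsOver_affine_of_perfect`);
* `CechPseudoCoherentAt.sectionsOver_basicOpen` — its basic-open form by localization (statement
  of `grothendieckComplex_sectionsOver_basicOpen` at `X`; proof of
  `grothendieckComplex_sectionsOver_basicOpen_of_affine`);
* `CechPseudoCoherentAt.sectionsOver` — Grauert's theorem in degree `0` for `𝒪(D)` on `X ×_K T → T`
  (statement of `grothendieckComplex_sectionsOver` at `X`; proof of
  `grothendieckComplex_sectionsOver_of_basicOpen`, gluing);
* `CechPseudoCoherentAt.exists_isSectionOver_nonvanishing` — Thm. 23.140 (3) in degree `0`: if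
  `𝒪(D)|_{X_t}` is trivial for all `t`, around every `t₀` a section of `𝒪(D)` over some `pr_T⁻¹U` not
  vanishing identically on `X_{t₀}` (statement of `cohomologyBaseChange_exists_isSectionOver` at `X`;
  proof of `cohomologyBaseChange_exists_isSectionOver_of_grothendieckComplex_sectionsOver`);
* `CechPseudoCoherentAt.exists_linEquiv_classPullback_snd` — **the Seesaw Theorem, Görtz–Wedhorn
  II, Thm. 24.66 with (1), for this `X`**: on `X ×_K T`, `T` integral, a divisor class trivial on
  every fibre is `pr_T^*` of a class on `T` (statement of `seesaw_exists_linEquiv_classPullback` at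
  `X`; by `exists_linEquiv_classPullback_snd_of_forall_exists_isSectionOver`, i.e. Cor. 24.63 and
  Lemma 24.67).

No named facts are introduced; nothing new is claimed mathematically. Mathlib searched (pin): no
cohomology and base change, no Grauert theorem (`Mathlib/AlgebraicGeometry` has none of Chapter 23
of Görtz–Wedhorn II).

## References

* U. Görtz, T. Wedhorn, *Algebraic Geometry II: Cohomology of Schemes*, Springer Spektrum (2023),
  doi:10.1007/978-3-658-43031-3: Prop. 22.53, p. 360; Thm. 23.133, Rem. 23.134, Cor. 23.135,
  Cor. 23.137, pp. 478–480; (23.28.5)–(23.28.6), p. 482; Prop. 23.128 and Thm. 23.140 (3) with its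
  proof, pp. 474, 482–483; Cor. 24.63, p. 539; Thm. 24.66 and its proof, Lemma 24.67, pp. 542–546
  (read via the held copy). [GortzWedhorn2023]
* D. Mumford, *Abelian Varieties*, TIFR Studies in Mathematics 5 (1970), §5 (the Grothendieck
  complex, Lemmas 1–2; Cor. 6, the seesaw principle). [MumfordAV1970]
-/

universe u

open CategoryTheory CategoryTheory.Limits AlgebraicGeometry TopologicalSpace Opposite TensorProduct
open MonoidalCategory CartesianMonoidalCategory Matrix
open Literature.AlgebraicGeometry.Motives.RatFn
open Literature.Algebra.Homology Literature.Algebra.Homology.OrderedCech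

noncomputable section

namespace Literature.AlgebraicGeometry.Motives

namespace CechPseudoCoherentAt

variable {K : Type u} [Field K] {X : SchemeOver K} [IsProper X.hom] [GeometricallyIntegral X.hom]

set_option maxHeartbeats 800000 in
/-- **The affine form of the Grothendieck complex of `𝒪(D)` in degree `0`, for a fixed `X` with
pseudo-coherent Čech complexes** (Görtz–Wedhorn II, Cor. 23.135 / Cor. 23.137 with
(23.28.5)–(23.28.6), along the printed proof, pp. 478–482, and Mumford, *Abelian Varieties*, §5; the
statement of `grothendieckComplex_sectionsOver_affine` of `Motives/SeesawGrauertLocalization` at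
`X`): every `t₀ ∈ T` has an affine open neighbourhood `V` carrying a matrix `d` over `Γ(V, 𝒪_T)`, a
`Γ(V, 𝒪_T)`-linear `φ : Γ(pr_T⁻¹V, 𝒪(D)) ≅ Ker d` and `κ(t)`-linear `ψ_t : Γ(X_t, 𝒪(D_t)) ≅ Ker d(t)`,
`t ∈ V`, with `ψ_t(s|_{X_t}) = φ(s)(t)`. The proof of `grothendieckComplex_sectionsOver_affine_of_perfect`
(`Motives/SeesawGrauertAffineCech`): a Čech cover `𝔚` of `pr_T⁻¹V`, a perfect model `φ : P• → Č•`
(`exists_perfect`), the matrix of `d⁰_P` with its natural kernel isomorphisms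
(`exists_matrix_kerEquiv_baseChange_natural`), Mumford's Lemma 2 (`kerZeroBaseChangeMap_bijective`),
`Ker(d⁰_Č ⊗ A) = Γ(pr_T⁻¹V, 𝒪(D))`, `Ker(d⁰_Č ⊗ κ(t)) = Γ(X_t, 𝒪(D_t))`
(`sectionsOverModEquivKerBaseChange`, `sectionsEquivKerBaseChange`) and the naturality along
`A → κ(t)`. [cite: GortzWedhorn2023, Cor. 23.135 and Cor. 23.137 (p. 480) with (23.28.5)–(23.28.6) (p. 482)] -/
theorem sectionsOver_affine (hX : CechPseudoCoherentAt X) (T : SchemeOver K) [IsIntegral T.left]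
    [IsIntegral (X ⊗ T).left] (D : CartierDivisor (X ⊗ T).left) (t₀ : T.left) :
    ∃ (V : T.left.Opens) (hV : t₀ ∈ V) (_ : IsAffineOpen V) (m n : ℕ)
      (d : Matrix (Fin n) (Fin m) Γ(T.left, V)),
      letI := CartierDivisor.baseAlgebra (snd X T).left V (genericPoint_mem_preimage_snd_of_mem X T hV)
      ∃ (φ : D.sectionsOverMod (snd X T).left (genericPoint_mem_preimage_snd_of_mem X T hV) V le_rfl
          ≃ₗ[Γ(T.left, V)] LinearMap.ker d.mulVecLin)
        (ψ : ∀ (t : T.left) (ht : t ∈ V),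
          letI := fibreOverResidueField X T t
          (D.classPullback (X ◁ residuePtι T t).left).sections (T.left.residueField t)
            ≃ₗ[T.left.residueField t] LinearMap.ker (matrixFibre T.left V d t ht).mulVecLin),
        ∀ (t : T.left) (ht : t ∈ V)
          (s : D.sectionsOverMod (snd X T).left (genericPoint_mem_preimage_snd_of_mem X T hV) V le_rfl),
          letI := fibreOverResidueField X T t
          ((ψ t ht (D.restrictFibreSections ht ⟨s, s.2⟩) :
              LinearMap.ker (matrixFibre T.left V d t ht).mulVecLin) : Fin m → T.left.residueField t) =
            fun i => T.left.evaluation V t ht ((φ s : Fin m → Γ(T.left, V)) i) := by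
  -- an affine open `V ∋ t₀` and a Čech cover of `pr_T⁻¹V`
  obtain ⟨V, hVaff, ht₀V, -⟩ := (Opens.isBasis_iff_nbhd.1 T.left.isBasis_affineOpens)
    (show t₀ ∈ (⊤ : T.left.Opens) from trivial)
  have hgen := genericPoint_mem_preimage_snd_of_mem X T ht₀V
  haveI := quasiCompact_snd_left X T
  obtain ⟨𝔚⟩ := CartierDivisor.CechCover.nonempty (snd X T).left V D hVaff hgen
  -- a perfect model `φ : P• → Č•` of the Čech complex
  obtain ⟨P, φ, hφ, hGE, hLE, hfp⟩ := hX.exists_perfect T D V hVaff 𝔚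
  haveI := hφ
  haveI := hGE
  haveI := hLE
  haveI : 𝔚.complex.IsStrictlyLE 𝔚.r := 𝔚.isStrictlyLE_complex
  haveI : 𝔚.complex.IsStrictlyGE 0 := 𝔚.isStrictlyGE_complex
  haveI := flat_snd_left X T
  haveI := isSeparated_snd_left X T
  have hCflat : ∀ n, Module.Flat Γ(T.left, V) (𝔚.complex.X n) := fun n => 𝔚.flat_complex_X hVaff n
  haveI := (hfp 0).1
  haveI := (hfp 0).2
  haveI := (hfp 1).1
  haveI := (hfp 1).2
  have hPflat : ∀ n, Module.Flat Γ(T.left, V) (P.X n) := fun n => by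
    haveI := (hfp n).2
    infer_instance
  letI := CartierDivisor.baseAlgebra (snd X T).left V 𝔚.genericPoint_mem
  -- the matrix of `d⁰_P` with its natural kernel isomorphisms `ε_B : Ker(M ⊗ B) ≅ Ker(d⁰_P ⊗ B)`
  obtain ⟨m, n, M, ε, hε⟩ := exists_matrix_kerEquiv_baseChange_natural (P.d 0 1).hom
  -- `θ_B : Ker(d⁰_P ⊗ B) ≅ Ker(d⁰_Č ⊗ B)`, `v ↦ (φ⁰ ⊗ B) v`
  obtain ⟨θ, hθ⟩ : ∃ θ : ∀ (B : Type u) [CommRing B] [Algebra Γ(T.left, V) B],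
      LinearMap.ker ((P.d 0 1).hom.baseChange B) ≃ₗ[B]
        LinearMap.ker ((𝔚.complex.d 0 1).hom.baseChange B),
      ∀ (B : Type u) [CommRing B] [Algebra Γ(T.left, V) B]
        (x : LinearMap.ker ((P.d 0 1).hom.baseChange B)),
        (θ B x : B ⊗[Γ(T.left, V)] (𝔚.complex.X 0)) = kerZeroBaseChangeMap φ B x :=
    ⟨fun B _ _ => LinearEquiv.ofBijective _ (kerZeroBaseChangeMap_bijective φ B hPflat hCflat 𝔚.r),
      fun B _ _ x => rfl⟩
  -- the case `B = A`: `φ_V = castA ∘ ε_A⁻¹ ∘ θ_A⁻¹ ∘ Ψ_A`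
  have hMid : M.map (algebraMap Γ(T.left, V) Γ(T.left, V)) = M := by
    ext i j
    rfl
  let castA : LinearMap.ker (M.map (algebraMap Γ(T.left, V) Γ(T.left, V))).mulVecLin
      ≃ₗ[Γ(T.left, V)] LinearMap.ker M.mulVecLin :=
    LinearEquiv.ofEq _ _ (by rw [hMid])
  let φV : D.sectionsOverMod (snd X T).left 𝔚.genericPoint_mem V le_rfl ≃ₗ[Γ(T.left, V)]
      LinearMap.ker M.mulVecLin :=
    𝔚.sectionsOverModEquivKerBaseChange.trans
      ((((θ Γ(T.left, V)).symm.trans (ε Γ(T.left, V)).symm)).trans castA)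
  -- the case `B = κ(t)`: `ψ_t = ε_{κ(t)}⁻¹ ∘ θ_{κ(t)}⁻¹ ∘ Ψ_{κ(t)}`
  let ψ : ∀ (t : T.left) (ht : t ∈ V),
      letI := fibreOverResidueField X T t
      (D.classPullback (X ◁ residuePtι T t).left).sections (T.left.residueField t)
        ≃ₗ[T.left.residueField t] LinearMap.ker (matrixFibre T.left V M t ht).mulVecLin :=
    fun t ht =>
      letI := fibreOverResidueField X T t
      letI := evalAlgebra T t ht
      (𝔚.sectionsEquivKerBaseChange hVaff ht).trans
        ((θ (T.left.residueField t)).symm.trans (ε (T.left.residueField t)).symm)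
  refine ⟨V, ht₀V, hVaff, m, n, M, φV, ψ, ?_⟩
  -- the compatibility with restriction to the fibres
  intro t ht s
  letI := fibreOverResidueField X T t
  letI := evalAlgebra T t ht
  let u : Γ(T.left, V) →ₐ[Γ(T.left, V)] T.left.residueField t := Algebra.ofId _ _
  -- the coordinates `w` of `φ_V s` and their values `w'` at `t`
  let w : LinearMap.ker (M.map (algebraMap Γ(T.left, V) Γ(T.left, V))).mulVecLin :=
    (ε Γ(T.left, V)).symm ((θ Γ(T.left, V)).symm (𝔚.sectionsOverModEquivKerBaseChange s))
  let w' : LinearMap.ker (M.map (algebraMap Γ(T.left, V) (T.left.residueField t))).mulVecLin :=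
    ⟨fun j => u ((w : Fin m → Γ(T.left, V)) j), comp_mem_ker_mulVecLin_map u M w⟩
  have hθw : θ Γ(T.left, V) (ε Γ(T.left, V) w) = 𝔚.sectionsOverModEquivKerBaseChange s := by
    show θ Γ(T.left, V) (ε Γ(T.left, V) ((ε Γ(T.left, V)).symm ((θ Γ(T.left, V)).symm
      (𝔚.sectionsOverModEquivKerBaseChange s)))) = _
    rw [LinearEquiv.apply_symm_apply, LinearEquiv.apply_symm_apply]
  -- naturality of `ε` and `θ` along `u : A → κ(t)`
  have a3 : ((θ (T.left.residueField t) (ε (T.left.residueField t) w') :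
      LinearMap.ker ((𝔚.complex.d 0 1).hom.baseChange (T.left.residueField t))) :
        T.left.residueField t ⊗[Γ(T.left, V)] (𝔚.complex.X 0)) =
      u.toLinearMap.rTensor (𝔚.complex.X 0)
        ((θ Γ(T.left, V) (ε Γ(T.left, V) w) :
          LinearMap.ker ((𝔚.complex.d 0 1).hom.baseChange Γ(T.left, V))) :
            Γ(T.left, V) ⊗[Γ(T.left, V)] (𝔚.complex.X 0)) := by
    rw [hθ, hθ]
    exact rTensor_kerZeroBaseChangeMap φ _ u _ _ (hε _ _ u w w' fun j => rfl)
  have a4 : ((θ (T.left.residueField t) (ε (T.left.residueField t) w') :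
      LinearMap.ker ((𝔚.complex.d 0 1).hom.baseChange (T.left.residueField t))) :
        T.left.residueField t ⊗[Γ(T.left, V)] (𝔚.complex.X 0)) =
      (1 : T.left.residueField t) ⊗ₜ[Γ(T.left, V)] 𝔚.cochainOfSection s := by
    rw [a3, hθw, 𝔚.coe_sectionsOverModEquivKerBaseChange_apply, rTensor_one_tmul]
  -- ... meets the restriction to the fibre
  have a5 : 𝔚.sectionsEquivKerBaseChange hVaff ht (D.restrictFibreSections ht ⟨s, s.2⟩) =
      θ (T.left.residueField t) (ε (T.left.residueField t) w') :=
    Subtype.ext ((𝔚.coe_sectionsEquivKerBaseChange_restrictFibreSections hVaff ht s).trans a4.symm)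
  have hψ : ψ t ht (D.restrictFibreSections ht ⟨s, s.2⟩) = w' := by
    show (ε (T.left.residueField t)).symm ((θ (T.left.residueField t)).symm
      (𝔚.sectionsEquivKerBaseChange hVaff ht (D.restrictFibreSections ht ⟨s, s.2⟩))) = w'
    rw [a5, LinearEquiv.symm_apply_apply, LinearEquiv.symm_apply_apply]
  have key : ((ψ t ht (D.restrictFibreSections ht ⟨s, s.2⟩) :
      LinearMap.ker (matrixFibre T.left V M t ht).mulVecLin) : Fin m → T.left.residueField t) =
      fun i => T.left.evaluation V t ht ((φV s : Fin m → Γ(T.left, V)) i) := by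
    rw [hψ]
    rfl
  exact key

/-- **The basic-open form of the Grothendieck complex of `𝒪(D)` in degree `0`, for a fixed `X`, by
localization** (Görtz–Wedhorn II, Cor. 23.137 at the flat `A`-algebras `A_a`; the statement of
`grothendieckComplex_sectionsOver_basicOpen` of `Motives/SeesawGrauertGluing` at `X`). The proof of
`grothendieckComplex_sectionsOver_basicOpen_of_affine` (`Motives/SeesawGrauertLocalization`): both
`Γ(pr_T⁻¹T_a, 𝒪(D))` and `Ker(d|_{T_a})` are localizations away from `a` (`CartierDivisor.locEquiv`,
`kerRestrict_locEquiv`), and the fibre compatibility descends from `aᴺ s ∈ Γ(pr_T⁻¹V, 𝒪(D))`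
(`restrictFibre_ofSection_app_pow_mul`). [cite: GortzWedhorn2023, Cor. 23.137 (p. 480)] -/
theorem sectionsOver_basicOpen (hX : CechPseudoCoherentAt X) (T : SchemeOver K) [IsIntegral T.left]
    [IsIntegral (X ⊗ T).left] (D : CartierDivisor (X ⊗ T).left) (t₀ : T.left) :
    ∃ (V : T.left.Opens) (_ : t₀ ∈ V) (_ : IsAffineOpen V) (m n : ℕ)
      (d : Matrix (Fin n) (Fin m) Γ(T.left, V))
      (φ : ∀ (a : Γ(T.left, V)) (_ : (T.left.basicOpen a : Set T.left).Nonempty),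
        D.sectionsOver (snd X T).left (T.left.basicOpen a) ≃+
          matrixKerOver T.left d (T.left.basicOpen_le a))
      (ψ : ∀ (t : T.left) (ht : t ∈ V),
        letI := fibreOverResidueField X T t
        (D.classPullback (X ◁ residuePtι T t).left).sections (T.left.residueField t)
          ≃ₗ[T.left.residueField t] LinearMap.ker (matrixFibre T.left V d t ht).mulVecLin),
      (∀ (a b : Γ(T.left, V)) (hab : T.left.basicOpen b ≤ T.left.basicOpen a)
          (ha : (T.left.basicOpen a : Set T.left).Nonempty)
          (hb : (T.left.basicOpen b : Set T.left).Nonempty)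
          (s : D.sectionsOver (snd X T).left (T.left.basicOpen a)) (i : Fin m),
        (φ b hb ⟨s, D.sectionsOver_mono hab s.2⟩ : Fin m → Γ(T.left, T.left.basicOpen b)) i =
          T.left.presheaf.map (homOfLE hab).op
            ((φ a ha s : Fin m → Γ(T.left, T.left.basicOpen a)) i)) ∧
      (∀ (a : Γ(T.left, V)) (ha : (T.left.basicOpen a : Set T.left).Nonempty) (t : T.left)
          (hta : t ∈ T.left.basicOpen a) (s : D.sectionsOver (snd X T).left (T.left.basicOpen a)),
        letI := fibreOverResidueField X T t
        ((ψ t (T.left.basicOpen_le a hta) (D.restrictFibreSections hta s) :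
            LinearMap.ker (matrixFibre T.left V d t (T.left.basicOpen_le a hta)).mulVecLin) :
              Fin m → T.left.residueField t) =
          fun i => T.left.evaluation (T.left.basicOpen a) t hta
            ((φ a ha s : Fin m → Γ(T.left, T.left.basicOpen a)) i)) := by
  obtain ⟨V, ht₀V, hVaff, m, n, d, φV, ψ, hcompat⟩ := hX.sectionsOver_affine T D t₀
  -- notation and instances
  have hgen := genericPoint_mem_preimage_snd_of_mem X T ht₀V
  letI := CartierDivisor.baseAlgebra (snd X T).left V hgen
  haveI : Nonempty V := ⟨⟨t₀, ht₀V⟩⟩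
  haveI : QuasiCompact (snd X T).left := by
    change QuasiCompact (pullback.snd X.hom T.hom)
    infer_instance
  have hne : ∀ {a : Γ(T.left, V)}, (T.left.basicOpen a : Set T.left).Nonempty →
      genericPoint (X ⊗ T).left ∈ (snd X T).left ⁻¹ᵁ T.left.basicOpen a := fun ⟨t, ht⟩ =>
    genericPoint_mem_preimage_snd_of_mem X T ht
  -- the localized isomorphisms
  let L : ∀ (a : Γ(T.left, V)) (_ : (T.left.basicOpen a : Set T.left).Nonempty),
      D.sectionsOverMod (snd X T).left hgen (T.left.basicOpen a) (T.left.basicOpen_le a) ≃ₗ[Γ(T.left, V)]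
        LinearMap.ker (d.map (algebraMap Γ(T.left, V) Γ(T.left, T.left.basicOpen a))).mulVecLin :=
    fun a ha => CartierDivisor.locEquiv (snd X T).left D hgen d hVaff φV a (hne ha)
      (ne_zero_of_basicOpen_nonempty ha)
  let φb : ∀ (a : Γ(T.left, V)) (_ : (T.left.basicOpen a : Set T.left).Nonempty),
      D.sectionsOver (snd X T).left (T.left.basicOpen a) ≃+
        matrixKerOver T.left d (T.left.basicOpen_le a) := fun a ha =>
    ((CartierDivisor.sectionsOverAddEquiv (hgen := hgen) (T.left.basicOpen a)
      (T.left.basicOpen_le a)).trans (L a ha).toAddEquiv).trans (kerBasicOpenAddEquiv d a)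
  have hφb : ∀ (a : Γ(T.left, V)) (ha : (T.left.basicOpen a : Set T.left).Nonempty)
      (s : D.sectionsOver (snd X T).left (T.left.basicOpen a)) (i : Fin m),
      (φb a ha s : Fin m → Γ(T.left, T.left.basicOpen a)) i =
        (L a ha ⟨s, s.2⟩ : Fin m → Γ(T.left, T.left.basicOpen a)) i := fun a ha s i => rfl
  refine ⟨V, ht₀V, hVaff, m, n, d, φb, ψ, ?_, ?_⟩
  · -- naturality in `T_b ⊆ T_a`
    intro a b hab ha hb s i
    rw [hφb b hb, hφb a ha]
    have key := CartierDivisor.kerRestrict_locEquiv (snd X T).left D hgen d hVaff φV hab (hne ha)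
      (ne_zero_of_basicOpen_nonempty ha) (hne hb) (ne_zero_of_basicOpen_nonempty hb) ⟨s, s.2⟩
    have key' := congr_arg (fun v : LinearMap.ker (d.map (algebraMap Γ(T.left, V)
      Γ(T.left, T.left.basicOpen b))).mulVecLin => (v : Fin m → Γ(T.left, T.left.basicOpen b)) i) key
    simp only [CartierDivisor.coe_kerRestrict_apply] at key'
    exact key'.symm
  · -- compatibility with restriction to the fibres
    intro a ha t hta s
    letI := fibreOverResidueField X T t
    have htV : t ∈ V := T.left.basicOpen_le a hta
    obtain ⟨N, s', hs', hN⟩ := CartierDivisor.exists_pow_smul_locEquiv (snd X T).left D hgen d hVaff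
      φV a (hne ha) (ne_zero_of_basicOpen_nonempty ha) ⟨s, s.2⟩
    -- evaluate `a^N • φ_a(s) = φ_V(s')|_{T_a}` at `t`
    have hev : ∀ i : Fin m, T.left.evaluation V t htV a ^ N *
        T.left.evaluation (T.left.basicOpen a) t hta ((φb a ha s : Fin m → _) i) =
        T.left.evaluation V t htV ((φV s' : Fin m → Γ(T.left, V)) i) := by
      intro i
      have h1 := congr_arg (fun v : LinearMap.ker (d.map (algebraMap Γ(T.left, V)
        Γ(T.left, T.left.basicOpen a))).mulVecLin => (v : Fin m → Γ(T.left, T.left.basicOpen a)) i) hN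
      simp only [Submodule.coe_smul_of_tower, Pi.smul_apply, Algebra.smul_def, map_pow,
        coe_kerToKerBasicOpen_apply] at h1
      have h2 := congr_arg (T.left.evaluation (T.left.basicOpen a) t hta) h1
      rw [map_mul, map_pow] at h2
      have e1 : T.left.evaluation (T.left.basicOpen a) t hta
          (algebraMap Γ(T.left, V) Γ(T.left, T.left.basicOpen a) a) = T.left.evaluation V t htV a :=
        evaluation_map_homOfLE (T.left.basicOpen_le a) t hta a
      have e2 : T.left.evaluation (T.left.basicOpen a) t hta
          (algebraMap Γ(T.left, V) Γ(T.left, T.left.basicOpen a) ((φV s' : Fin m → Γ(T.left, V)) i)) =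
          T.left.evaluation V t htV ((φV s' : Fin m → Γ(T.left, V)) i) :=
        evaluation_map_homOfLE (T.left.basicOpen_le a) t hta _
      rw [e1, e2] at h2
      rw [hφb a ha]
      exact h2
    -- the compatibility at level `V` for `s'`, and restriction of `a^N s = s'` to `X_t`
    have hc := hcompat t htV s'
    have hres : D.restrictFibreSections htV ⟨s', s'.2⟩ =
        T.left.evaluation V t htV a ^ N • D.restrictFibreSections hta s := by
      apply Subtype.ext
      change D.restrictFibre X T t s' = algebraMap _ _ (T.left.evaluation V t htV a ^ N) *
        D.restrictFibre X T t s
      rw [← hs', map_pow]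
      exact CartierDivisor.restrictFibre_ofSection_app_pow_mul hta htV hgen a N s.2
    rw [hres, map_smul] at hc
    have hat : T.left.evaluation V t htV a ≠ 0 :=
      (T.left.evaluation_ne_zero_iff_mem_basicOpen t htV a).2 hta
    funext i
    have hci := congr_fun hc i
    simp only [SetLike.val_smul, Pi.smul_apply, smul_eq_mul] at hci
    rw [← hev i] at hci
    exact mul_left_cancel₀ (pow_ne_zero N hat) hci

/-- **Grauert's theorem in degree `0` for `𝒪(D)` on `X ×_K T → T`, for a fixed `X` with
pseudo-coherent Čech complexes** (Görtz–Wedhorn II, Cor. 23.135 in degree `0`,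
`f_*𝓕|_V ≅ Ker(d : 𝒪_V^m → 𝒪_V^n)` as sheaves on `V`, with (23.28.5)–(23.28.6) on the fibres; the
statement of the named fact `grothendieckComplex_sectionsOver` of `Motives/SeesawGrauert` at `X`).
The proof of `grothendieckComplex_sectionsOver_of_basicOpen` (`Motives/SeesawGrauertGluing`): glue
the isomorphisms on the basic opens (`exists_addEquiv_sectionsOver_matrixKerOver_natural`) and read
the fibre compatibility on a basic open `T_a ∋ t` below `U`.
[cite: GortzWedhorn2023, Cor. 23.135 (p. 480) with (23.28.5)–(23.28.6) (p. 482)] -/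
theorem sectionsOver (hX : CechPseudoCoherentAt X) (T : SchemeOver K) [IsIntegral T.left]
    [IsIntegral (X ⊗ T).left] (D : CartierDivisor (X ⊗ T).left) (t₀ : T.left) :
    ∃ (V : T.left.Opens) (_ : t₀ ∈ V) (m n : ℕ) (d : Matrix (Fin n) (Fin m) Γ(T.left, V))
      (φ : ∀ (U : T.left.Opens) (hUV : U ≤ V) (_ : (U : Set T.left).Nonempty),
        D.sectionsOver (snd X T).left U ≃+ matrixKerOver T.left d hUV)
      (ψ : ∀ (t : T.left) (ht : t ∈ V),
        letI := fibreOverResidueField X T t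
        (D.classPullback (X ◁ residuePtι T t).left).sections (T.left.residueField t)
          ≃ₗ[T.left.residueField t] LinearMap.ker (matrixFibre T.left V d t ht).mulVecLin),
      (∀ (U U' : T.left.Opens) (hUV : U ≤ V) (hU'U : U' ≤ U) (hU' : (U' : Set T.left).Nonempty)
          (s : D.sectionsOver (snd X T).left U) (i : Fin m),
        (φ U' (hU'U.trans hUV) hU' ⟨s, D.sectionsOver_mono hU'U s.2⟩ : Fin m → Γ(T.left, U')) i =
          T.left.presheaf.map (homOfLE hU'U).op
            ((φ U hUV (hU'.mono hU'U) s : Fin m → Γ(T.left, U)) i)) ∧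
      (∀ (U : T.left.Opens) (hUV : U ≤ V) (t : T.left) (htU : t ∈ U)
          (s : D.sectionsOver (snd X T).left U),
        letI := fibreOverResidueField X T t
        ((ψ t (hUV htU) (D.restrictFibreSections htU s) :
            LinearMap.ker (matrixFibre T.left V d t (hUV htU)).mulVecLin) :
              Fin m → T.left.residueField t) =
          fun i => T.left.evaluation U t htU ((φ U hUV ⟨t, htU⟩ s : Fin m → Γ(T.left, U)) i)) := by
  obtain ⟨V, ht₀V, hV, m, n, d, φb, ψ, hnat, hcompat⟩ := hX.sectionsOver_basicOpen T D t₀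
  obtain ⟨φ, hφnat, hφb⟩ :=
    exists_addEquiv_sectionsOver_matrixKerOver_natural (π := (snd X T).left) (D := D) hV d φb hnat
  refine ⟨V, ht₀V, m, n, d, φ, ψ, hφnat, fun U hUV t htU s => ?_⟩
  -- read the compatibility off a basic open `T_a ∋ t` below `U`
  obtain ⟨a, haU, hta⟩ := hV.exists_basicOpen_le ⟨t, htU⟩ (hUV htU)
  let α : BasicOpenBelow V U := ⟨a, haU, ⟨t, hta⟩⟩
  have e : D.restrictFibreSections htU s =
      D.restrictFibreSections hta ⟨s, D.sectionsOver_mono haU s.2⟩ := Subtype.ext rfl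
  rw [e, hcompat a ⟨t, hta⟩ t hta ⟨s, D.sectionsOver_mono haU s.2⟩]
  funext i
  rw [← hφb U hUV ⟨t, htU⟩ s α i, evaluation_map_homOfLE]

/-- **Görtz–Wedhorn II, Thm. 23.140 (3) (Grauert) in degree `0` for `𝒪(D)` on `X ×_K T → T`, for a
fixed `X`, along the printed proof** (p. 483; the statement of the named fact
`cohomologyBaseChange_exists_isSectionOver` of `Motives/SeesawCohomologyBaseChange` at `X`): if
`𝒪(D)|_{X_t}` is trivial for every `t`, then around every `t₀` there is a section
`s ∈ Γ(pr_T⁻¹U, 𝒪(D))` generating `𝒪(D)` at some point over `t₀`. The proof of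
`cohomologyBaseChange_exists_isSectionOver_of_grothendieckComplex_sectionsOver`
(`Motives/SeesawGrauert`): `dim Ker d(t) = h⁰(X_t, 𝒪(D_t)) = 1` on `V` (`h0_eq_one_of_linEquiv_zero`,
Cor. 24.63), so by Prop. 23.128 (`exists_mulVec_eq_zero_isUnit_of_finrank_ker_eq_one`) a kernel vector
over some `U ∋ t₀` has a unit coordinate, and the corresponding section does not vanish on `X_{t₀}`.
[cite: GortzWedhorn2023, Thm. 23.140 (3) (p. 482), proof (p. 483)] -/
theorem exists_isSectionOver_nonvanishing (hX : CechPseudoCoherentAt X) (T : SchemeOver K)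
    [IsIntegral T.left] [IsIntegral (X ⊗ T).left] (D : CartierDivisor (X ⊗ T).left)
    (hD : ∀ t : T.left, t ∈ CartierDivisor.trivialLocus X T D) (t₀ : T.left) :
    ∃ (U : T.left.Opens) (s : (X ⊗ T).left.functionField), t₀ ∈ U ∧
      D.IsSectionOver (snd X T).left U s ∧
      ∃ x : (X ⊗ T).left, (snd X T).left x = t₀ ∧ x ∈ D.nonvanishing s := by
  obtain ⟨V, hV, m, n, d, φ, ψ, -, hcompat⟩ := hX.sectionsOver T D t₀
  -- all fibres trivial, so `dim Ker d(t) = h⁰(X_t, 𝒪(D_t)) = 1` on `V`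
  have hker : ∀ (t : T.left) (ht : t ∈ V), Module.finrank (T.left.residueField t)
      (LinearMap.ker (matrixFibre T.left V d t ht).mulVecLin) = 1 := fun t ht => by
    letI := fibreOverResidueField X T t
    haveI : IsProper ((X ⊗ residuePt T t).left ↘ Spec (.of (T.left.residueField t))) :=
      inferInstanceAs (IsProper (pullback.snd X.hom (residuePt T t).hom))
    haveI : GeometricallyIntegral
        ((X ⊗ residuePt T t).left ↘ Spec (.of (T.left.residueField t))) :=
      inferInstanceAs (GeometricallyIntegral (pullback.snd X.hom (residuePt T t).hom))
    haveI := isIso_appTop_of_geometricallyIntegral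
      ((X ⊗ residuePt T t).left ↘ Spec (.of (T.left.residueField t)))
    rw [← (ψ t ht).finrank_eq]
    exact h0_eq_one_of_linEquiv_zero (T.left.residueField t) (hD t)
  -- Prop. 23.128: a kernel vector `v` over some `U ∋ t₀` with a unit coordinate
  obtain ⟨U, hUV, ht₀U, v, hv, j, hj⟩ :=
    exists_mulVec_eq_zero_isUnit_of_finrank_ker_eq_one d hV hker
  -- the corresponding section `s ∈ Γ(pr_T⁻¹U, 𝒪(D))` restricts non-trivially to `X_{t₀}`
  set s : D.sectionsOver (snd X T).left U :=
    (φ U hUV ⟨t₀, ht₀U⟩).symm ⟨v, mem_matrixKerOver_iff.2 hv⟩ with hs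
  have hφs : (φ U hUV ⟨t₀, ht₀U⟩ s : Fin m → Γ(T.left, U)) = v := by
    rw [hs, AddEquiv.apply_symm_apply]
  refine ⟨U, s, ht₀U, s.2, ?_⟩
  refine CartierDivisor.exists_mem_nonvanishing_of_restrictFibre_ne_zero ht₀U s.2 fun h0 => ?_
  have h1 := hcompat U hUV t₀ ht₀U s
  have h2 : D.restrictFibreSections ht₀U s = 0 := Subtype.ext h0
  rw [h2, map_zero, hφs] at h1
  exact evaluation_ne_zero_of_isUnit hj t₀ ht₀U h1.symm

/-- **The Seesaw Theorem for a fixed `X` with pseudo-coherent Čech complexes** (Görtz–Wedhorn II,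
Thm. 24.66 with (1), over a field: on `X ×_K T`, `X` proper geometrically integral, `T` integral, a
divisor class trivial on every fibre `X_t` is `pr_T^*` of a class on `T`; the statement of the named
fact `seesaw_exists_linEquiv_classPullback` of `Motives/SeesawTheorem` at `X`), along the printed
proof (pp. 544–546): cohomology and base change in degree `0` (`exists_isSectionOver_nonvanishing`,
Thm. 23.140 (3)), `𝒪_T = pr_{T,*}𝒪_{X × T}` (Cor. 24.63, `snd_app_bijective_holds`), local triviality
over `T` and descent of the transition functions (Lemma 24.67) — packaged as
`exists_linEquiv_classPullback_snd_of_forall_exists_isSectionOver`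
(`Motives/SeesawCohomologyBaseChange`). [cite: GortzWedhorn2023, Thm. 24.66, proof (pp. 544–546)] -/
theorem exists_linEquiv_classPullback_snd (hX : CechPseudoCoherentAt X) (T : SchemeOver K)
    [IsIntegral T.left] [IsIntegral (X ⊗ T).left] (D : CartierDivisor (X ⊗ T).left)
    (hD : ∀ t : T.left, t ∈ CartierDivisor.trivialLocus X T D) :
    ∃ M : CartierDivisor T.left, D.LinEquiv (M.classPullback (snd X T).left) :=
  exists_linEquiv_classPullback_snd_of_forall_exists_isSectionOver hD
    (hX.exists_isSectionOver_nonvanishing T D hD)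

end CechPseudoCoherentAt

end Literature.AlgebraicGeometry.Motives

end
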